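import Literature.Probability.Percolation.ArmSeparationRotate
import HarnessLib

/-!
# Sectors of the six rotated frames outside `Λ_{2M}`

Topic: Probability / Percolation; family `crit-perc`. A brick of the discharge of
`Literature.Probability.Percolation.Nolin2008_twoArm_separation` (Nolin 2008, Thm. 11
[arXiv 0711.4948: Thm. 10]; `ArmSeparation.lean`), landing of the EXTERNAL extremities (mirror of
`ArmSeparationSectors.lean` for the rotations `ρ^i` instead of the frames `frameIso i`). The
corridors of a tip fenced behind side `0` of the rotated frame `i` start in the **near sector**
`rotNear i M lam m₀ = ρ^i {x | 2M ≤ x₀ ≤ 2M + lam, -2M + m₀ ≤ x₁ ≤ -m₀}` (depth `lam` beyond the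
side, rows at least `m₀` away from its ends); the approach tube of the open arm lies in the
**long sector** `{x | 2M ≤ x₀, -2M + m₀ ≤ x₁ ≤ -m₀}` of the original frame. Explicit coordinates
of the rotations show that near sectors of distinct frames are disjoint, and that the long sector
of the frame `0` misses the near sectors of the other frames, as soon as `lam < m₀`
(`rotNear_disjoint_rotNear`, `longSector_disjoint_rotNear`).

## References

* P. Nolin, *Near-critical percolation in two dimensions*, Electron. J. Probab. 13 (2008), §4.3
  Lemma 13 (disjoint supports), §4.4 [arXiv 0711.4948: Lemma 12, Thm. 10]. [Nolin2008]
-/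

noncomputable section

open Set

namespace Literature.Probability.Percolation

open LatticeModels

/-- **The near sector of the frame `i`**: `ρ^i` of the box `[2M, 2M + lam] × [-2M + m₀, -m₀]`
beyond side `0`. [cite: Nolin2008, §4.3 Lemma 13 (arXiv 0711.4948: Lemma 12, disjoint supports)] -/
def rotNear (i M lam m₀ : ℕ) : Set (Site 2) :=
  triRotIsoPow i '' {x | 2 * (M : ℤ) ≤ x 0 ∧ x 0 ≤ 2 * (M : ℤ) + lam ∧ -(2 * (M : ℤ)) + m₀ ≤ x 1 ∧ x 1 ≤ -(m₀ : ℤ)}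

/-- **The long sector of the original frame**: `{2M ≤ x₀, -2M + m₀ ≤ x₁ ≤ -m₀}`. [cite: Nolin2008, §4.3 Lemma 13 (arXiv 0711.4948: Lemma 12, disjoint supports)] -/
def longSector (M m₀ : ℕ) : Set (Site 2) :=
  {x | 2 * (M : ℤ) ≤ x 0 ∧ -(2 * (M : ℤ)) + m₀ ≤ x 1 ∧ x 1 ≤ -(m₀ : ℤ)}

/-- The near sector of the frame `0` lies in the long sector. [folklore] -/
theorem rotNear_zero_subset (M lam m₀ : ℕ) : rotNear 0 M lam m₀ ⊆ longSector M m₀ := by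
  rintro v ⟨x, ⟨h1, -, h3, h4⟩, rfl⟩
  obtain ⟨f0, f1, -⟩ := rot_apply_formula x
  exact ⟨by rw [f0]; exact h1, by rw [f1]; exact h3, by rw [f1]; exact h4⟩

/-- **The long sector of the frame `0` misses the near sectors of the other frames**
(`0 < d < 6`, `lam < m₀`). [cite: Nolin2008, §4.3 Lemma 13 (arXiv 0711.4948: Lemma 12)] -/
theorem longSector_disjoint_rotNear {M lam m₀ d : ℕ} (hd0 : d ≠ 0) (hd : d < 6) (hlam : lam < m₀) :
    Disjoint (longSector M m₀) (rotNear d M lam m₀) := by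
  have hlam' : (lam : ℤ) < m₀ := by exact_mod_cast hlam
  rw [Set.disjoint_left]
  rintro v ⟨hv1, hv2, hv3⟩ ⟨y, ⟨hy1, hy2, hy3, hy4⟩, rfl⟩
  obtain ⟨-, -, a0, a1, b0, b1, c0, c1, d0, d1, e0, e1⟩ := rot_apply_formula y
  interval_cases d
  · exact hd0 rfl
  · rw [a0] at hv1; omega
  · rw [b1] at hv3; omega
  · rw [c0] at hv1; omega
  · rw [d0] at hv1; omega
  · rw [e0] at hv1; omega

/-- Rotating back by `i`: `ρ^i x = ρ^j y` gives `x = ρ^d y` with `d = (j + 6 - i) % 6` (`i < 6`). [folklore] -/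
theorem eq_rot_of_rot_eq_rot {i j : ℕ} (hi : i < 6) {x y : Site 2} (h : triRotIsoPow i x = triRotIsoPow j y) :
    x = triRotIsoPow ((j + (6 - i)) % 6) y := by
  have key : triRotIsoPow ((j + (6 - i)) % 6 + i) y = triRotIsoPow i (triRotIsoPow ((j + (6 - i)) % 6) y) :=
    triRotIsoPow_add_apply _ _ _
  have hj : triRotIsoPow ((j + (6 - i)) % 6 + i) y = triRotIsoPow j y := by
    rw [← triRotIsoPow_mod_six_apply ((j + (6 - i)) % 6 + i), show ((j + (6 - i)) % 6 + i) % 6 = j % 6 by omega,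
      triRotIsoPow_mod_six_apply]
  rw [hj] at key
  exact (triRotIsoPow i).injective (h.trans key)

/-- **Near sectors of distinct frames are disjoint** (`i ≠ j`, both `< 6`, `lam < m₀`). [cite: Nolin2008, §4.3 Lemma 13 (arXiv 0711.4948: Lemma 12)] -/
theorem rotNear_disjoint_rotNear {M lam m₀ i j : ℕ} (hi : i < 6) (hj : j < 6) (hij : i ≠ j) (hlam : lam < m₀) :
    Disjoint (rotNear i M lam m₀) (rotNear j M lam m₀) := by
  rw [Set.disjoint_left]
  rintro v ⟨x, hx, rfl⟩ ⟨y, hy, hyx⟩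
  have hxy := eq_rot_of_rot_eq_rot hi hyx.symm
  set d := (j + (6 - i)) % 6 with hd
  have hd6 : d < 6 := Nat.mod_lt _ (by norm_num)
  have hd0 : d ≠ 0 := by
    intro h0
    rw [hd] at h0
    omega
  have hdis := longSector_disjoint_rotNear (M := M) (lam := lam) (m₀ := m₀) hd0 hd6 hlam
  rw [Set.disjoint_left] at hdis
  exact hdis ⟨hx.1, hx.2.2.1, hx.2.2.2⟩ ⟨y, hy, hxy.symm⟩

/-- **The long sector of the frame `i` misses the near sectors of the other frames**: if
`ρ^i x` with `x` in the long sector equals `ρ^j y` with `y` in the near box (`i ≠ j`), contradiction. [cite: Nolin2008, §4.3 Lemma 13 (arXiv 0711.4948: Lemma 12)] -/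
theorem image_longSector_disjoint_rotNear {M lam m₀ i j : ℕ} (hi : i < 6) (hj : j < 6) (hij : i ≠ j) (hlam : lam < m₀) :
    Disjoint (triRotIsoPow i '' longSector M m₀) (rotNear j M lam m₀) := by
  rw [Set.disjoint_left]
  rintro v ⟨x, hx, rfl⟩ ⟨y, hy, hyx⟩
  have hxy := eq_rot_of_rot_eq_rot hi hyx.symm
  set d := (j + (6 - i)) % 6 with hd
  have hd6 : d < 6 := Nat.mod_lt _ (by norm_num)
  have hd0 : d ≠ 0 := by
    intro h0
    rw [hd] at h0
    omega
  have hdis := longSector_disjoint_rotNear (M := M) (lam := lam) (m₀ := m₀) hd0 hd6 hlam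
  rw [Set.disjoint_left] at hdis
  exact hdis hx ⟨y, hy, hxy.symm⟩

end Literature.Probability.Percolation
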